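import Literature.Geometry.Lorentzian.CarterHorizonPocket
import HarnessLib

/-!
# Carter's coefficient in the threshold cone: two-sided profile bounds with the `σ`-correction
(namespace `Literature.Geometry.Lorentzian.Kerr`.)

Carter's radial equation `u″ + φu = 0`, `φ = ω² − V∘ρ` (`V = Kerr.sepPotential M a ω m Λ`; DRSR
arXiv:1402.7034 §5.2.3) on a sub-extremal Kerr exterior, at a frequency `ω` near the superradiant
threshold, `σ := ω − mω₊`. With `Λ′ = Λ − 2amω`, `Δ = (r − r₊)(r − r₋)`, `h = (r − r₊)/(r − r₋)`,
`W₁ = (r² + a²)²V₁ ∈ [0, 3Δ]` and `K = (r₊² + a²)σ + ω(r − r₊)(r + r₊)`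
(`Kerr.radialK_eq_horizon_add`), the identity `(r² + a²)²(V − ω²) = ΔΛ′ + W₁ − K²`
(`Kerr.sq_mul_coeff_eq`) and `(ω(r − r₊)(r + r₊))² = Δ·ω²(r + r₊)²h` give, for every `ε > 0`
(Peter–Paul on the cross term of `K²`):

* `sq_mul_negCoeff_ge_of_cone` —
  `Δ·[Λ′ − (1 + ε)ω²(r + r₊)²h] − (1 + ε⁻¹)(r₊² + a²)²σ² ≤ (r² + a²)²(V − ω²)`;
* `sq_mul_negCoeff_le_of_cone` —
  `(r² + a²)²(V − ω²) ≤ Δ·[Λ′ − (1 − ε)ω²(r + r₊)²h + 3] + (ε⁻¹ − 1)(r₊² + a²)²σ²`;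
* `sq_mul_negCoeff_ge_of_cone'` — the `r`-form lower bound (`h ≤ 1`):
  `Δ·[Λ′ − (1 + ε)ω²(r + r₊)²] − (1 + ε⁻¹)(r₊² + a²)²σ² ≤ (r² + a²)²(V − ω²)`.

At `σ = 0` these reduce (with `ε → 0`) to the exact threshold profile of `CarterThresholdRate.lean`;
for `|σ| = 2κ|ξ|` small (`(r₊² + a²)²σ² = (r₊² + a²)²·4κ²ξ²` against `Δ ≍ κ²·x` near the horizon)
they are the rate inputs of the threshold SLIVER and of the collar rates off the threshold
(near-extremal Kerr programme, BF-stable large-`Λ` kernel bound). Pure algebra; all proved.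

## References
* M. Dafermos, I. Rodnianski, Y. Shlapentokh-Rothman, arXiv:1402.7034 = Ann. of Math. 183 (2016),
  §§5.2.3, 6.2 (key `DafermosRodnianskiShlapentokhrothman2014`). The algebra is folklore.
-/

noncomputable section

open Set

namespace Literature.Geometry.Lorentzian

namespace Kerr

section Cone

variable {M a ω Λ : ℝ} {m : ℤ}

/-- The square of the regular part of `K`: `(ω(r − r₊)(r + r₊))² = Δ·ω²(r + r₊)²·(r − r₊)/(r − r₋)`
for `r > r₊` (`|a| < M`). [folklore] -/
theorem sq_omega_mul_eq_delta_mul (ha : |a| < M) {r : ℝ} (hr : rPlus M a < r) :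
    (ω * (r - rPlus M a) * (r + rPlus M a)) ^ 2 =
      delta M a r * (ω ^ 2 * (r + rPlus M a) ^ 2 * ((r - rPlus M a) / (r - rMinus M a))) := by
  have hsub : IsSubextremal M a := ha
  have hrm : r - rMinus M a ≠ 0 := by linarith [hsub.rMinus_lt_rPlus]
  rw [delta_eq_mul ha.le r]
  field_simp

/-- **Lower profile bound in the cone**: for `|a| < M`, `r > r₊`, `ε > 0`, `σ = ω − mω₊`:
`Δ·[Λ′ − (1 + ε)ω²(r + r₊)²h] − (1 + ε⁻¹)(r₊² + a²)²σ² ≤ (r² + a²)²(V(r) − ω²)`. [folklore] -/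
theorem sq_mul_negCoeff_ge_of_cone (ha : |a| < M) {ε : ℝ} (hε : 0 < ε) {r : ℝ} (hr : rPlus M a < r) :
    delta M a r * (Λ - 2 * a * m * ω - (1 + ε) * (ω ^ 2 * (r + rPlus M a) ^ 2 *
        ((r - rPlus M a) / (r - rMinus M a)))) -
        (1 + ε⁻¹) * ((rPlus M a ^ 2 + a ^ 2) * (ω - m * horizonAngularVelocity M a)) ^ 2 ≤
      (r ^ 2 + a ^ 2) ^ 2 * (sepPotential M a ω m Λ r - ω ^ 2) := by
  have hM : 0 < M := lt_of_le_of_lt (abs_nonneg a) ha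
  have hrp : 0 < rPlus M a := rPlus_pos hM a
  have hr0 : 0 < r := hrp.trans hr
  have hA : r ^ 2 + a ^ 2 ≠ 0 := by positivity
  have h := sq_mul_coeff_eq M a ω m Λ hA
  have hK := radialK_eq_horizon_add hM ha.le ω m r
  have hB := sq_omega_mul_eq_delta_mul (ω := ω) ha hr
  have hV₁ : 0 ≤ (r ^ 2 + a ^ 2) ^ 2 * sepPotential₁ M a r :=
    mul_nonneg (sq_nonneg _) (sepPotential₁_nonneg ha.le hr.le)
  set A := (rPlus M a ^ 2 + a ^ 2) * (ω - m * horizonAngularVelocity M a) with hAdef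
  set B := ω * (r - rPlus M a) * (r + rPlus M a) with hBdef
  -- Peter–Paul: `K² = (A + B)² ≤ (1 + ε)B² + (1 + ε⁻¹)A²`
  have hpp : (A + B) ^ 2 ≤ (1 + ε) * B ^ 2 + (1 + ε⁻¹) * A ^ 2 := by
    have h0 : 0 ≤ (ε * B - A) ^ 2 / ε := div_nonneg (sq_nonneg _) hε.le
    have e : (1 + ε) * B ^ 2 + (1 + ε⁻¹) * A ^ 2 - (A + B) ^ 2 = (ε * B - A) ^ 2 / ε := by
      field_simp; ring
    linarith
  have hK' : radialK a ω m r = A + B := by rw [hK, hAdef, hBdef]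
  rw [hK'] at h
  -- `(r²+a²)²(V − ω²) = ΔΛ′ + W₁ − K²`
  have e1 : (r ^ 2 + a ^ 2) ^ 2 * (sepPotential M a ω m Λ r - ω ^ 2) =
      delta M a r * (Λ - 2 * a * m * ω) + (r ^ 2 + a ^ 2) ^ 2 * sepPotential₁ M a r - (A + B) ^ 2 := by
    linarith
  rw [e1]
  nlinarith [hpp, hB, hV₁]

/-- **Upper profile bound in the cone**: for `|a| < M`, `r > r₊`, `ε > 0`, `σ = ω − mω₊`:
`(r² + a²)²(V(r) − ω²) ≤ Δ·[Λ′ − (1 − ε)ω²(r + r₊)²h + 3] + (ε⁻¹ − 1)(r₊² + a²)²σ²`. [folklore] -/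
theorem sq_mul_negCoeff_le_of_cone (ha : |a| < M) {ε : ℝ} (hε : 0 < ε) {r : ℝ} (hr : rPlus M a < r) :
    (r ^ 2 + a ^ 2) ^ 2 * (sepPotential M a ω m Λ r - ω ^ 2) ≤
      delta M a r * (Λ - 2 * a * m * ω - (1 - ε) * (ω ^ 2 * (r + rPlus M a) ^ 2 *
        ((r - rPlus M a) / (r - rMinus M a))) + 3) +
        (ε⁻¹ - 1) * ((rPlus M a ^ 2 + a ^ 2) * (ω - m * horizonAngularVelocity M a)) ^ 2 := by
  have hM : 0 < M := lt_of_le_of_lt (abs_nonneg a) ha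
  have hrp : 0 < rPlus M a := rPlus_pos hM a
  have hr0 : 0 < r := hrp.trans hr
  have hA : r ^ 2 + a ^ 2 ≠ 0 := by positivity
  have h := sq_mul_coeff_eq M a ω m Λ hA
  have hK := radialK_eq_horizon_add hM ha.le ω m r
  have hB := sq_omega_mul_eq_delta_mul (ω := ω) ha hr
  have hV₁ := sq_mul_sepPotential₁_le hM ha.le hr.le
  set A := (rPlus M a ^ 2 + a ^ 2) * (ω - m * horizonAngularVelocity M a) with hAdef
  set B := ω * (r - rPlus M a) * (r + rPlus M a) with hBdef
  -- Peter–Paul: `K² = (A + B)² ≥ (1 − ε)B² + (1 − ε⁻¹)A²`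
  have hpp : (1 - ε) * B ^ 2 + (1 - ε⁻¹) * A ^ 2 ≤ (A + B) ^ 2 := by
    have h0 : 0 ≤ (ε * B + A) ^ 2 / ε := div_nonneg (sq_nonneg _) hε.le
    have e : (A + B) ^ 2 - ((1 - ε) * B ^ 2 + (1 - ε⁻¹) * A ^ 2) = (ε * B + A) ^ 2 / ε := by
      field_simp; ring
    linarith
  have hK' : radialK a ω m r = A + B := by rw [hK, hAdef, hBdef]
  rw [hK'] at h
  have e1 : (r ^ 2 + a ^ 2) ^ 2 * (sepPotential M a ω m Λ r - ω ^ 2) =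
      delta M a r * (Λ - 2 * a * m * ω) + (r ^ 2 + a ^ 2) ^ 2 * sepPotential₁ M a r - (A + B) ^ 2 := by
    linarith
  rw [e1]
  nlinarith [hpp, hB, hV₁]

/-- **Lower profile bound in the cone, `r`-form** (`h ≤ 1`): for `|a| < M`, `r > r₊`, `ε > 0`:
`Δ·[Λ′ − (1 + ε)ω²(r + r₊)²] − (1 + ε⁻¹)(r₊² + a²)²σ² ≤ (r² + a²)²(V(r) − ω²)` — the barrier
coefficient is bounded below by a κ-explicit positive quantity wherever
`(1 + ε)ω²(r + r₊)² < Λ′` and `Δ(r)` beats the `σ²`-term (collar rates in the threshold cone).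
[folklore] -/
theorem sq_mul_negCoeff_ge_of_cone' (ha : |a| < M) {ε : ℝ} (hε : 0 < ε) {r : ℝ} (hr : rPlus M a < r) :
    delta M a r * (Λ - 2 * a * m * ω - (1 + ε) * (ω ^ 2 * (r + rPlus M a) ^ 2)) -
        (1 + ε⁻¹) * ((rPlus M a ^ 2 + a ^ 2) * (ω - m * horizonAngularVelocity M a)) ^ 2 ≤
      (r ^ 2 + a ^ 2) ^ 2 * (sepPotential M a ω m Λ r - ω ^ 2) := by
  have hsub : IsSubextremal M a := ha
  have hrm : 0 < r - rMinus M a := by linarith [hsub.rMinus_lt_rPlus]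
  have hh : (r - rPlus M a) / (r - rMinus M a) ≤ 1 := by
    rw [div_le_one hrm]; linarith [hsub.rMinus_lt_rPlus]
  have hΔ : 0 ≤ delta M a r := delta_nonneg ha.le hr.le
  have h := sq_mul_negCoeff_ge_of_cone (ω := ω) (Λ := Λ) (m := m) ha hε hr
  have h0 : 0 ≤ (1 + ε) * (ω ^ 2 * (r + rPlus M a) ^ 2) := by positivity
  have h1 : delta M a r * (Λ - 2 * a * m * ω - (1 + ε) * (ω ^ 2 * (r + rPlus M a) ^ 2)) ≤
      delta M a r * (Λ - 2 * a * m * ω - (1 + ε) * (ω ^ 2 * (r + rPlus M a) ^ 2 *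
        ((r - rPlus M a) / (r - rMinus M a)))) := by
    apply mul_le_mul_of_nonneg_left _ hΔ
    have : (1 + ε) * (ω ^ 2 * (r + rPlus M a) ^ 2 * ((r - rPlus M a) / (r - rMinus M a))) ≤
        (1 + ε) * (ω ^ 2 * (r + rPlus M a) ^ 2) := by
      rw [← mul_assoc (1 + ε)]
      calc (1 + ε) * (ω ^ 2 * (r + rPlus M a) ^ 2) * ((r - rPlus M a) / (r - rMinus M a))
          ≤ (1 + ε) * (ω ^ 2 * (r + rPlus M a) ^ 2) * 1 := mul_le_mul_of_nonneg_left hh h0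
        _ = (1 + ε) * (ω ^ 2 * (r + rPlus M a) ^ 2) := mul_one _
    linarith
  linarith

end Cone

end Kerr

end Literature.Geometry.Lorentzian

end
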